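import Literature.MathematicalPhysics.QuantumFieldTheory.Balaban1983to89.T4NestedCovariance
import Literature.MathematicalPhysics.QuantumFieldTheory.Balaban1983to89.T4FlatExteriorInvariance

/-!
# Bałaban 1983–89, node O3.E-i′ (α): LIAISON — the single-scale fibre operation of `T4DressingDefect` /
# `T4FlatExteriorInvariance` as an ADAPTED FORM of `T4NestedCovariance`

HONEST FRAMING (cell `pub-balaban`, T4-DAG rung (B)+1 scoping; GAPS G-pv06g7-1, partial).  This module proves NO
statement of [Balaban1987RG1], [Balaban1988Convergent], [Balaban1989LargeFieldI].  It is kernel bookkeeping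
([folklore]) joining two landed leaves:

* `T4NestedCovariance` (row T4-O3.E-i′-Oα6°): the joint global colour rotation survives any NESTING of integral
  operations whose nodes carry one-level hypotheses (`Form`, `Form.Adapted`, `Form.covariant_eval`,
  `Form.eval_eq_zero_of_conjEquivariant`), stated over an abstract configuration type `Ω` with maps `ρ g : Ω → Ω`;
* `T4FlatExteriorInvariance` (row T4-O3.E-i′-Oα): ONE LEVEL on the tree's configuration type `GaugeField P j G`
  with the constant conjugation `conjFun g` — conjugation-invariant weights (`ConjInvariant`), product-Haar
  invariance (`pi_haar_map_conjFun`), invariance of the fibre / conditional laws `fibreLaw` / `condLaw` of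
  `T4DressingDefect` at a conjugation-fixed exterior (`fibreLaw_map_conjFun`, `condLaw_map_conjFun`).

WHAT IS DONE HERE.  On ONE scale, `Ω := GaugeField P j G`, `ρ g := conjFun g` (`jrot`):
(i) the `Form.mul` node clause IS `ConjInvariant` (`invariant_jrot_iff`), so every `…_conjInvariant` fact of
`T4FlatExteriorInvariance` certifies a weight node (`adapted_mul_of_conjInvariant` and three instances);
(ii) the `Form.fibre` node clause for the product Haar measure on the bond variables of a finite set `s`
(`invariantFibre_piHaar`, from `pi_haar_map_conjFun` through `invariantFibre_of_inverse`) with the JOINT insertion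
identity `conjFun g (V←y) = (conjFun g V)←(conjFun g y)` (`updateFinset_jrot` — no fixed-exterior hypothesis: the
exterior is rotated too; `EquivariantInsertion`);
(iii) the un-normalised one-step fibre operation `F ↦ (V ↦ ∫ old(V←y) F(V←y) dy)` and its normalised version
(conditional expectation) as forms `fibreForm s old` / `condForm s old`, ADAPTED as soon as `ConjInvariant old`
(`adapted_fibreForm`, `adapted_condForm`) — hence covariant, commuting with every continuous linear automorphism of
the value space, and with output ZERO on conjugation-equivariant traceless `𝔰𝔲(2)`-inserts at a conjugation-fixed
exterior (`fibreForm_eval_eq_zero`, `condForm_eval_eq_zero`, `meanVanishes_condForm`), with NO integrability or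
measurability binder on the insert, and NESTED TO ANY DEPTH at a configuration fixed by all conjugations
(`pi_eval_eq_zero_of_fixed`, `pi_eval_eq_zero_unitField`);
(iv) IDENTIFICATION with the tree's literal laws: `∫ F(V←y) d(fibreLaw s old V)(y) = (fibreForm s old).eval F V` and
`∫ F(V←y) d(condLaw s old V)(y) = (condForm s old).eval F V` for a measurable non-negative `old`
(`integral_fibreLaw_eq_eval`, `integral_condLaw_eq_eval`; `condMean_eq_eval`), and the adapter `ofFibre` turning an
insert of the fibre variables `f : (s → G) → E` (the shape used in
`T4FlatExteriorInvariance.integral_condLaw_eq_zero`) into an insert of the whole configuration.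

WHAT IS NOT DONE (the honest remainder of G-pv06g7-1).  The forms of `T4NestedCovariance` act on ONE configuration
type; the printed operations that change scale (the averaging constraints `δ(V̄_j V_{j+1}⁻¹)` of (2.21), the
background / minimiser substitutions (1.81) — obligations O-α4) need `Ω` to be the multi-scale total configuration
space and are NOT instantiated here; nor is the full (1.100) tree assembled.  Printed context (renders certified,
GAPS C-pv06g7-1; no new quotation in this module): [Balaban1988Convergent] (2.21) p. 258 — the one-step operation
«involves integration with respect to the gauge field variables V_j on Ω^c_{j+1}∩X»; [Balaban1989LargeFieldI]
(1.100) p. 201.  Records: `t4/T4-EST-O3Ei-alpha6.md` (pv06-g7), `t4/T4-XREAD-O3Ei-alpha.md` (pv04-g6).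
Value = kernel liaison, NOT summit progress (rung (B)+1 ≠ infinite volume / mass gap / Clay).
-/

open MeasureTheory Function
open scoped BigOperators ENNReal

namespace Literature.MathematicalPhysics.QuantumFieldTheory.Balaban1983to89.T4NestedCovarianceFibre

open T4NestedCovariance T4DressingDefect T4AdInvariant T4FirstOrderSize GaugeField
open T4FlatExteriorInvariance hiding conjEquiv coe_conjEquiv

/-! ## §1  The joint rotation on one scale and the node clauses -/

section Nodes

variable {P : Params} {j : ℕ} {G : Type*} [GaugeGroup G]

/-- THE JOINT ROTATION on one scale's configuration space: constant conjugation of every bond variable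
(`T4FlatExteriorInvariance.conjFun`), as the family of maps `ρ g` of `T4NestedCovariance`. [folklore] -/
abbrev jrot : G → GaugeField P j G → GaugeField P j G := fun g U => conjFun g U

/-- The weight-node clause of `T4NestedCovariance` IS `ConjInvariant`. [folklore] -/
theorem invariant_jrot_iff {α : Type*} (χ : GaugeField P j G → α) :
    Invariant (jrot (P := P) (j := j) (G := G)) χ ↔ ConjInvariant χ := Iff.rfl

/-- Every conjugation-invariant weight is an adapted `Form.mul` node. [folklore] -/
theorem adapted_mul_of_conjInvariant {χ : GaugeField P j G → ℝ} (hχ : ConjInvariant χ) :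
    (Form.mul χ : Form (GaugeField P j G) ℝ).Adapted (jrot (G := G)) := hχ

/-- Instance: the small-field characteristic functions `chiSmall` are adapted weight nodes. [folklore] -/
theorem adapted_mul_chiSmall (S : Set (Plaq P j)) (δ : ℝ) :
    (Form.mul (chiSmall (G := G) S δ) : Form (GaugeField P j G) ℝ).Adapted (jrot (G := G)) :=
  chiSmall_conjInvariant S δ

/-- Instance: the Wilson weight `exp(−A(U))` is an adapted weight node. [folklore] -/
theorem adapted_mul_expWilson (w : ℝ) :
    (Form.mul fun U : GaugeField P j G => Real.exp (-(wilsonAction w U)) : Form (GaugeField P j G) ℝ).Adapted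
      (jrot (G := G)) :=
  (wilsonAction_conjInvariant w).comp fun x => Real.exp (-x)

/-- Instance: the gauge-fixing function of a contour datum is an adapted weight node. [folklore] -/
theorem adapted_mul_gaugeFixFn (cd : ContourData P j G) (Y : Finset (Site P (j+1))) :
    (Form.mul (gaugeFixFn cd Y) : Form (GaugeField P j G) ℝ).Adapted (jrot (G := G)) :=
  gaugeFixFn_conjInvariant cd Y

/-- A substitution node by a conjugation-covariant self-map of the configuration space is adapted. [folklore] -/
theorem adapted_subst_of_covariant {τ : GaugeField P j G → GaugeField P j G}
    (hτ : ∀ (g : G) (U : GaugeField P j G), τ (conjFun g U) = conjFun g (τ U)) :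
    (Form.subst τ : Form (GaugeField P j G) ℝ).Adapted (jrot (G := G)) := hτ

variable [DecidableEq (PBond P j)]

/-- THE JOINT INSERTION IDENTITY: rotating the whole configuration after inserting fibre variables = inserting the
rotated fibre variables into the ROTATED configuration — for every exterior (contrast
`T4FlatExteriorInvariance.updateFinset_conjFun`, where the exterior is fixed and not rotated). [folklore] -/
theorem updateFinset_jrot (s : Finset (PBond P j)) (g : G) (y : s → G) (V : GaugeField P j G) :
    conjFun g (updateFinset V s y) = updateFinset (conjFun g V) s (conjFun g y) := by
  funext b
  by_cases hb : b ∈ s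
  · simp only [updateFinset, conjFun_apply, dif_pos hb]
  · simp only [updateFinset, conjFun_apply, dif_neg hb]

/-- Inserting fibre variables is an `EquivariantInsertion` for the joint rotation. [folklore] -/
theorem equivariantInsertion_updateFinset (s : Finset (PBond P j)) :
    EquivariantInsertion (jrot (P := P) (j := j) (G := G)) (fun g => conjFun (ι := ↥s) g)
      (fun y V => updateFinset V s y) :=
  fun g y V => updateFinset_jrot s g y V

variable [MeasurableSpace G]

/-- Any measure on a family space invariant under simultaneous conjugation is an `InvariantFibre` for it (the
measurable-embedding clause comes from the inverse conjugation). [folklore] -/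
theorem invariantFibre_of_map_conjFun [MeasurableMul G] {ι : Type*} {ν : Measure (ι → G)}
    (hν : ∀ g : G, ν.map (conjFun g) = ν) : InvariantFibre (fun g => conjFun (ι := ι) g) ν :=
  invariantFibre_of_inverse (fun g => g⁻¹) (fun g => measurable_conjFun g) (fun g y => conjFun_inv_conjFun g y)
    (fun g y => conjFun_conjFun_inv g y) hν

/-- THE FIBRE-NODE CLAUSE for the product Haar measure on the bond variables of a finite index type. [folklore] -/
theorem invariantFibre_piHaar [MeasurableMul G] [HaarData G] (ι : Type*) [Fintype ι] :
    InvariantFibre (fun g => conjFun (ι := ι) g) (Measure.pi fun _ : ι => (HaarData.haar : Measure G)) :=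
  invariantFibre_of_map_conjFun fun g => pi_haar_map_conjFun g

end Nodes

/-! ## §2  The one-step fibre operation and the conditional expectation as forms -/

section Forms

variable {P : Params} {j : ℕ} {G : Type*} [GaugeGroup G] [MeasurableSpace G] [HaarData G]
variable [DecidableEq (PBond P j)]

/-- THE BARE FIBRE NODE over `s`: `F ↦ (V ↦ ∫ F(V←y) dy)`, `dy` = product of the normalised Haar measures over the
bond variables `b ∈ s`. [folklore] -/
noncomputable def fibreNode (s : Finset (PBond P j)) : Form (GaugeField P j G) ℝ :=
  Form.fibre (↥s → G) inferInstance (Measure.pi fun _ : ↥s => (HaarData.haar : Measure G))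
    fun y V => updateFinset V s y

/-- THE ONE-STEP FIBRE OPERATION with integrated density `old`: `F ↦ (V ↦ ∫ old(V←y) · F(V←y) dy)` — the
bare fibre node after the weight node `old`. [folklore] -/
noncomputable def fibreForm (s : Finset (PBond P j)) (old : Density P j G) : Form (GaugeField P j G) ℝ :=
  Form.comp (fibreNode s) (Form.mul old)

/-- THE CONDITIONAL EXPECTATION `F ↦ E[F | V⌈_{sᶜ}] = (∫ old(V←y) dy)⁻¹ ∫ old(V←y) F(V←y) dy` as a form
(`Form.cond` with the bare fibre node as normalising operation; junk value when the normaliser vanishes, as for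
`condLaw`). [folklore] -/
noncomputable def condForm (s : Finset (PBond P j)) (old : Density P j G) : Form (GaugeField P j G) ℝ :=
  Form.cond (fibreNode s) old (fibreNode s)

/-- `condForm` is the normaliser node after `fibreForm`. [folklore] -/
theorem condForm_eq (s : Finset (PBond P j)) (old : Density P j G) :
    condForm s old = Form.comp (Form.mul (Form.normaliser (fibreNode s) old)) (fibreForm s old) := rfl

variable {E : Type*} [NormedAddCommGroup E] [NormedSpace ℝ E]

/-- Unfolding the bare fibre node. [folklore] -/
@[simp] theorem eval_fibreNode (s : Finset (PBond P j)) (F : GaugeField P j G → E) (V : GaugeField P j G) :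
    (fibreNode s : Form (GaugeField P j G) ℝ).eval F V
      = ∫ y, F (updateFinset V s y) ∂(Measure.pi fun _ : ↥s => (HaarData.haar : Measure G)) := rfl

/-- Unfolding the one-step fibre operation. [folklore] -/
@[simp] theorem eval_fibreForm (s : Finset (PBond P j)) (old : Density P j G) (F : GaugeField P j G → E)
    (V : GaugeField P j G) :
    (fibreForm s old).eval F V
      = ∫ y, old (updateFinset V s y) • F (updateFinset V s y)
          ∂(Measure.pi fun _ : ↥s => (HaarData.haar : Measure G)) :=
  rfl

/-- Unfolding the conditional form. [folklore] -/
theorem eval_condForm (s : Finset (PBond P j)) (old : Density P j G) (F : GaugeField P j G → E)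
    (V : GaugeField P j G) :
    (condForm s old).eval F V
      = (∫ y, old (updateFinset V s y) ∂(Measure.pi fun _ : ↥s => (HaarData.haar : Measure G)))⁻¹
          • (fibreForm s old).eval F V := rfl

omit [GaugeGroup G] [MeasurableSpace G] [HaarData G] in
/-- THE FIBRE OPERATIONS SEE THE EXTERIOR ONLY: two configurations that agree off `s` give the same output.
[folklore] -/
theorem updateFinset_congr_off {s : Finset (PBond P j)} {V V' : GaugeField P j G} (h : ∀ b ∉ s, V b = V' b)
    (y : s → G) : updateFinset V s y = updateFinset V' s y := by
  funext b
  by_cases hb : b ∈ s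
  · simp only [updateFinset, dif_pos hb]
  · simp only [updateFinset, dif_neg hb, h b hb]

/-- `fibreForm` depends on the exterior `V⌈_{sᶜ}` only. [folklore] -/
theorem eval_fibreForm_congr_off (s : Finset (PBond P j)) (old : Density P j G) (F : GaugeField P j G → E)
    {V V' : GaugeField P j G} (h : ∀ b ∉ s, V b = V' b) :
    (fibreForm s old).eval F V = (fibreForm s old).eval F V' := by
  simp only [eval_fibreForm, updateFinset_congr_off h]

/-- `condForm` depends on the exterior `V⌈_{sᶜ}` only. [folklore] -/
theorem eval_condForm_congr_off (s : Finset (PBond P j)) (old : Density P j G) (F : GaugeField P j G → E)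
    {V V' : GaugeField P j G} (h : ∀ b ∉ s, V b = V' b) :
    (condForm s old).eval F V = (condForm s old).eval F V' := by
  simp only [eval_condForm, eval_fibreForm, updateFinset_congr_off h]

/-- At an exterior fixed by conjugation by `g` off `s` (`ConjFixedOff`), the output of `fibreForm` is unchanged by
the joint rotation (the `hfix` hypothesis of `T4NestedCovariance`'s consumers). [folklore] -/
theorem eval_fibreForm_jrot_of_fixedOff (s : Finset (PBond P j)) (old : Density P j G) (F : GaugeField P j G → E)
    {g : G} {V : GaugeField P j G} (hV : ConjFixedOff s g V) :
    (fibreForm s old).eval F (conjFun g V) = (fibreForm s old).eval F V :=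
  eval_fibreForm_congr_off s old F fun b hb => hV b hb

/-- The same for `condForm`. [folklore] -/
theorem eval_condForm_jrot_of_fixedOff (s : Finset (PBond P j)) (old : Density P j G) (F : GaugeField P j G → E)
    {g : G} {V : GaugeField P j G} (hV : ConjFixedOff s g V) :
    (condForm s old).eval F (conjFun g V) = (condForm s old).eval F V :=
  eval_condForm_congr_off s old F fun b hb => hV b hb

variable [MeasurableMul G]

/-- THE BARE FIBRE NODE IS ADAPTED to the joint rotation (product Haar invariant, insertion equivariant). [folklore] -/
theorem adapted_fibreNode (s : Finset (PBond P j)) :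
    (fibreNode s : Form (GaugeField P j G) ℝ).Adapted (jrot (G := G)) :=
  ⟨fun g => conjFun (ι := ↥s) g, invariantFibre_piHaar (G := G) (↥s), equivariantInsertion_updateFinset s⟩

/-- THE ONE-STEP FIBRE OPERATION IS ADAPTED as soon as the integrated density is conjugation invariant. [folklore] -/
theorem adapted_fibreForm (s : Finset (PBond P j)) {old : Density P j G} (hold : ConjInvariant old) :
    (fibreForm s old).Adapted (jrot (G := G)) :=
  ⟨adapted_fibreNode s, hold⟩

/-- THE CONDITIONAL EXPECTATION IS ADAPTED under the same hypothesis. [folklore] -/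
theorem adapted_condForm (s : Finset (PBond P j)) {old : Density P j G} (hold : ConjInvariant old) :
    (condForm s old).Adapted (jrot (G := G)) :=
  Form.adapted_cond (adapted_fibreNode s) (adapted_fibreNode s) hold

/-- Hence COVARIANT under the joint rotation (`Form.covariant_eval`). [folklore] -/
theorem covariant_fibreForm (s : Finset (PBond P j)) {old : Density P j G} (hold : ConjInvariant old) :
    Covariant (jrot (G := G)) ((fibreForm s old).eval : Op (GaugeField P j G) E) :=
  Form.covariant_eval _ (adapted_fibreForm s hold)

/-- … and the conditional expectation too. [folklore] -/
theorem covariant_condForm (s : Finset (PBond P j)) {old : Density P j G} (hold : ConjInvariant old) :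
    Covariant (jrot (G := G)) ((condForm s old).eval : Op (GaugeField P j G) E) :=
  Form.covariant_eval _ (adapted_condForm s hold)

/-- A NESTED product of one-step fibre operations over any list of (region, density) pairs is adapted. [folklore] -/
theorem adapted_pi_fibreForm (L : List (Finset (PBond P j) × Density P j G)) (hL : ∀ p ∈ L, ConjInvariant p.2) :
    (Form.pi (L.map fun p => fibreForm p.1 p.2)).Adapted (jrot (G := G)) :=
  Form.adapted_pi fun f hf => by
    obtain ⟨p, hp, rfl⟩ := List.mem_map.mp hf
    exact adapted_fibreForm p.1 (hL p hp)

end Forms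

/-! ## §3  Identification with `fibreLaw` / `condLaw` / `condMean` of `T4DressingDefect` -/

section Identification

variable {P : Params} {j : ℕ} {G : Type*} [GaugeGroup G] [MeasurableSpace G] [HaarData G]
variable [DecidableEq (PBond P j)]
variable {E : Type*} [NormedAddCommGroup E] [NormedSpace ℝ E]

/-- `∫ F(V←y) d(fibreLaw s old V)(y) = (fibreForm s old).eval F V` for a measurable non-negative integrated density
(the `withDensity` integral formula; no hypothesis on `F`). [folklore] -/
theorem integral_fibreLaw_eq_eval (s : Finset (PBond P j)) {old : Density P j G} (hm : Measurable old)
    (h0 : ∀ U, 0 ≤ old U) (F : GaugeField P j G → E) (V : GaugeField P j G) :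
    ∫ y, F (updateFinset V s y) ∂(fibreLaw s old V) = (fibreForm s old).eval F V := by
  have hdens : Measurable fun y : ↥s → G => ENNReal.ofReal (old (updateFinset V s y)) :=
    ENNReal.measurable_ofReal.comp (hm.comp measurable_updateFinset)
  rw [fibreLaw, integral_withDensity_eq_integral_toReal_smul hdens
    (Filter.Eventually.of_forall fun _ => ENNReal.ofReal_lt_top), eval_fibreForm]
  refine integral_congr_ae (Filter.Eventually.of_forall fun y => ?_)
  simp only [ENNReal.toReal_ofReal (h0 _)]

/-- The total mass of the fibre law is the bare fibre node applied to the density. [folklore] -/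
theorem toReal_fibreLaw_univ_eq_eval (s : Finset (PBond P j)) {old : Density P j G} (hm : Measurable old)
    (h0 : ∀ U, 0 ≤ old U) (V : GaugeField P j G) :
    (fibreLaw s old V Set.univ).toReal = (fibreNode s : Form (GaugeField P j G) ℝ).eval (E := ℝ) old V := by
  rw [fibreLaw, withDensity_apply _ MeasurableSet.univ, Measure.restrict_univ, eval_fibreNode,
    integral_eq_lintegral_of_nonneg_ae (Filter.Eventually.of_forall fun y => h0 _)
      (hm.comp measurable_updateFinset).aestronglyMeasurable]

/-- `∫ F(V←y) d(condLaw s old V)(y) = (condForm s old).eval F V` (both sides carry the same junk value when the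
normaliser vanishes). [folklore] -/
theorem integral_condLaw_eq_eval (s : Finset (PBond P j)) {old : Density P j G} (hm : Measurable old)
    (h0 : ∀ U, 0 ≤ old U) (F : GaugeField P j G → E) (V : GaugeField P j G) :
    ∫ y, F (updateFinset V s y) ∂(condLaw s old V) = (condForm s old).eval F V := by
  rw [condLaw, integral_smul_measure, integral_fibreLaw_eq_eval s hm h0 F V, ENNReal.toReal_inv,
    toReal_fibreLaw_univ_eq_eval s hm h0 V]
  rfl

/-- The conditional mean `condMean s old F V` of `T4DressingDefect` is `(condForm s old).eval F V`. [folklore] -/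
theorem condMean_eq_eval (s : Finset (PBond P j)) {old : Density P j G} (hm : Measurable old)
    (h0 : ∀ U, 0 ≤ old U) (F : Density P j G) (V : GaugeField P j G) :
    condMean s old F V = (condForm s old).eval F V :=
  integral_condLaw_eq_eval s hm h0 F V

/-- ADAPTER: an insert of the fibre variables only, read as an insert of the whole configuration (restriction to
`s`). [folklore] -/
def ofFibre {α : Type*} (s : Finset (PBond P j)) (f : (↥s → G) → α) : GaugeField P j G → α :=
  fun V => f fun b => V b

omit [GaugeGroup G] [MeasurableSpace G] [HaarData G] in
/-- Inserting `y` and restricting to `s` gives back `y`. [folklore] -/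
@[simp] theorem ofFibre_updateFinset {α : Type*} (s : Finset (PBond P j)) (f : (↥s → G) → α)
    (V : GaugeField P j G) (y : s → G) : ofFibre s f (updateFinset V s y) = f y := by
  unfold ofFibre
  congr 1
  funext b
  simp only [updateFinset, dif_pos b.2, Subtype.coe_eta]

omit [MeasurableSpace G] [HaarData G] [DecidableEq (PBond P j)] in
/-- Restriction commutes with the joint rotation. [folklore] -/
theorem ofFibre_jrot {α : Type*} (s : Finset (PBond P j)) (f : (↥s → G) → α) (g : G) (V : GaugeField P j G) :
    ofFibre s f (conjFun g V) = f (conjFun g fun b => V b) := rfl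

/-- The law-level integral of a fibre insert is the form applied to its adapter. [folklore] -/
theorem integral_condLaw_eq_eval_ofFibre (s : Finset (PBond P j)) {old : Density P j G} (hm : Measurable old)
    (h0 : ∀ U, 0 ≤ old U) (f : (↥s → G) → E) (V : GaugeField P j G) :
    ∫ y, f y ∂(condLaw s old V) = (condForm s old).eval (ofFibre s f) V := by
  rw [← integral_condLaw_eq_eval s hm h0 (ofFibre s f) V]
  simp only [ofFibre_updateFinset]

end Identification

/-! ## §4  The 𝔰𝔲(2) consequences: zero conditional means, nested to any depth, no binder on the insert -/

section SpecialUnitary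

open Matrix

variable {P : Params} {j : ℕ} [DecidableEq (PBond P j)]

omit [DecidableEq (PBond P j)] in
/-- A conjugation-equivariant insert of the fibre variables (`T4AdInvariant.conjAll`) is a conjugation-equivariant
insert of the whole configuration. [folklore] -/
theorem conjEquivariant_ofFibre (s : Finset (PBond P j))
    {f : (↥s → specialUnitaryGroup (Fin 2) ℂ) → Fin 2 → Fin 2 → ℂ}
    (hf : ConjEquivariant (conjAll (ι := ↥s)) f) :
    ConjEquivariant (jrot (P := P) (j := j) (G := specialUnitaryGroup (Fin 2) ℂ)) (ofFibre s f) :=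
  fun h V => hf h fun b => V b

/-- ZERO OUTPUT of the one-step fibre operation on a conjugation-equivariant, pointwise traceless insert at an
exterior fixed by every constant conjugation off `s` (e.g. flat) — no integrability, no measurability. [folklore] -/
theorem fibreForm_eval_eq_zero (s : Finset (PBond P j)) {old : Density P j (specialUnitaryGroup (Fin 2) ℂ)}
    (hold : ConjInvariant old) {V : GaugeField P j (specialUnitaryGroup (Fin 2) ℂ)}
    (hV : ∀ g : specialUnitaryGroup (Fin 2) ℂ, ConjFixedOff s g V)
    {F : GaugeField P j (specialUnitaryGroup (Fin 2) ℂ) → Fin 2 → Fin 2 → ℂ}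
    (hF : ConjEquivariant (jrot (P := P) (j := j) (G := specialUnitaryGroup (Fin 2) ℂ)) F)
    (htr : ∀ U, F U 0 0 + F U 1 1 = 0) : (fibreForm s old).eval F V = 0 :=
  Form.eval_eq_zero_of_conjEquivariant (fibreForm s old) (adapted_fibreForm s hold) hF htr
    fun g => eval_fibreForm_jrot_of_fixedOff s old F (hV g)

/-- ZERO CONDITIONAL EXPECTATION under the same hypotheses. [folklore] -/
theorem condForm_eval_eq_zero (s : Finset (PBond P j)) {old : Density P j (specialUnitaryGroup (Fin 2) ℂ)}
    (hold : ConjInvariant old) {V : GaugeField P j (specialUnitaryGroup (Fin 2) ℂ)}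
    (hV : ∀ g : specialUnitaryGroup (Fin 2) ℂ, ConjFixedOff s g V)
    {F : GaugeField P j (specialUnitaryGroup (Fin 2) ℂ) → Fin 2 → Fin 2 → ℂ}
    (hF : ConjEquivariant (jrot (P := P) (j := j) (G := specialUnitaryGroup (Fin 2) ℂ)) F)
    (htr : ∀ U, F U 0 0 + F U 1 1 = 0) : (condForm s old).eval F V = 0 :=
  Form.eval_eq_zero_of_conjEquivariant (condForm s old) (adapted_condForm s hold) hF htr
    fun g => eval_condForm_jrot_of_fixedOff s old F (hV g)

/-- The same at a FLAT exterior `V⌈_{sᶜ} = 1`. [folklore] -/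
theorem condForm_eval_eq_zero_of_flat (s : Finset (PBond P j)) {old : Density P j (specialUnitaryGroup (Fin 2) ℂ)}
    (hold : ConjInvariant old) {V : GaugeField P j (specialUnitaryGroup (Fin 2) ℂ)} (hV : ∀ b ∉ s, V b = 1)
    {F : GaugeField P j (specialUnitaryGroup (Fin 2) ℂ) → Fin 2 → Fin 2 → ℂ}
    (hF : ConjEquivariant (jrot (P := P) (j := j) (G := specialUnitaryGroup (Fin 2) ℂ)) F)
    (htr : ∀ U, F U 0 0 + F U 1 1 = 0) : (condForm s old).eval F V = 0 :=
  condForm_eval_eq_zero s hold (fun g => conjFixedOff_of_flat hV g) hF htr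

/-- RECOVERING the law-level statement `T4FlatExteriorInvariance.integral_condLaw_eq_zero` for a measurable
non-negative density, through the form (consistency check of the liaison). [folklore] -/
theorem integral_condLaw_eq_zero' (s : Finset (PBond P j)) {old : Density P j (specialUnitaryGroup (Fin 2) ℂ)}
    (hm : Measurable old) (h0 : ∀ U, 0 ≤ old U) (hold : ConjInvariant old)
    {V : GaugeField P j (specialUnitaryGroup (Fin 2) ℂ)}
    (hV : ∀ g : specialUnitaryGroup (Fin 2) ℂ, ConjFixedOff s g V)
    {f : (↥s → specialUnitaryGroup (Fin 2) ℂ) → Fin 2 → Fin 2 → ℂ}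
    (hf : ConjEquivariant (conjAll (ι := ↥s)) f) (htr : ∀ y, f y 0 0 + f y 1 1 = 0) :
    ∫ y, f y ∂(condLaw s old V) = 0 := by
  rw [integral_condLaw_eq_eval_ofFibre s hm h0 f V]
  exact condForm_eval_eq_zero s hold hV (conjEquivariant_ofFibre s hf) fun U => htr _

/-- THE `MeanVanishes` CURRENCY of `T4FirstOrderSize`, entrywise, for the conditional expectation computed by the
form — WITHOUT the integrability binder of `T4FlatExteriorInvariance.meanVanishes_condLaw`. [folklore] -/
theorem meanVanishes_condForm (s : Finset (PBond P j)) {old : Density P j (specialUnitaryGroup (Fin 2) ℂ)}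
    (hold : ConjInvariant old) {V : GaugeField P j (specialUnitaryGroup (Fin 2) ℂ)}
    (hV : ∀ g : specialUnitaryGroup (Fin 2) ℂ, ConjFixedOff s g V) {β : Type*} (S : Finset β)
    (B : GaugeField P j (specialUnitaryGroup (Fin 2) ℂ) → β → Fin 2 → Fin 2 → ℂ)
    (hB : ∀ b ∈ S, ConjEquivariant (jrot (P := P) (j := j) (G := specialUnitaryGroup (Fin 2) ℂ)) fun U => B U b)
    (htr : ∀ b ∈ S, ∀ U, B U b 0 0 + B U b 1 1 = 0) (i k : Fin 2) :
    MeanVanishes S fun b => (condForm s old).eval (fun U => B U b) V i k := fun b hb => by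
  have h := condForm_eval_eq_zero s hold hV (hB b hb) (htr b hb)
  simp only [h, Pi.zero_apply]

omit [DecidableEq (PBond P j)] in
/-- NESTED TO ANY DEPTH: a product of adapted forms (e.g. one-step fibre operations over different regions with
conjugation-invariant densities, `adapted_pi_fibreForm`, interleaved with invariant weights) kills every
conjugation-equivariant traceless insert at a configuration fixed by all constant conjugations. [folklore] -/
theorem pi_eval_eq_zero_of_fixed (fs : List (Form (GaugeField P j (specialUnitaryGroup (Fin 2) ℂ)) ℝ))
    (hfs : ∀ f ∈ fs, f.Adapted (jrot (P := P) (j := j) (G := specialUnitaryGroup (Fin 2) ℂ)))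
    {V : GaugeField P j (specialUnitaryGroup (Fin 2) ℂ)}
    (hV : ∀ g : specialUnitaryGroup (Fin 2) ℂ, conjFun g V = V)
    {F : GaugeField P j (specialUnitaryGroup (Fin 2) ℂ) → Fin 2 → Fin 2 → ℂ}
    (hF : ConjEquivariant (jrot (P := P) (j := j) (G := specialUnitaryGroup (Fin 2) ℂ)) F)
    (htr : ∀ U, F U 0 0 + F U 1 1 = 0) : (Form.pi fs).eval F V = 0 :=
  Form.eval_eq_zero_of_conjEquivariant (Form.pi fs) (Form.adapted_pi hfs) hF htr fun g => by
    show (Form.pi fs).eval F (conjFun g V) = _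
    rw [hV g]

omit [DecidableEq (PBond P j)] in
/-- In particular at the UNIT configuration (the flat field). [folklore] -/
theorem pi_eval_eq_zero_unitField (fs : List (Form (GaugeField P j (specialUnitaryGroup (Fin 2) ℂ)) ℝ))
    (hfs : ∀ f ∈ fs, f.Adapted (jrot (P := P) (j := j) (G := specialUnitaryGroup (Fin 2) ℂ)))
    {F : GaugeField P j (specialUnitaryGroup (Fin 2) ℂ) → Fin 2 → Fin 2 → ℂ}
    (hF : ConjEquivariant (jrot (P := P) (j := j) (G := specialUnitaryGroup (Fin 2) ℂ)) F)
    (htr : ∀ U, F U 0 0 + F U 1 1 = 0) :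
    (Form.pi fs).eval F (1 : GaugeField P j (specialUnitaryGroup (Fin 2) ℂ)) = 0 :=
  pi_eval_eq_zero_of_fixed fs hfs (fun g => conjFun_unitField g) hF htr

/-- The nested product of one-step fibre operations over a list of (region, invariant density) pairs kills every
conjugation-equivariant traceless insert at the unit configuration. [folklore] -/
theorem pi_fibreForm_eval_eq_zero_unitField
    (L : List (Finset (PBond P j) × Density P j (specialUnitaryGroup (Fin 2) ℂ)))
    (hL : ∀ p ∈ L, ConjInvariant p.2)
    {F : GaugeField P j (specialUnitaryGroup (Fin 2) ℂ) → Fin 2 → Fin 2 → ℂ}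
    (hF : ConjEquivariant (jrot (P := P) (j := j) (G := specialUnitaryGroup (Fin 2) ℂ)) F)
    (htr : ∀ U, F U 0 0 + F U 1 1 = 0) :
    (Form.pi (L.map fun p => fibreForm p.1 p.2)).eval F (1 : GaugeField P j (specialUnitaryGroup (Fin 2) ℂ)) = 0 :=
  pi_eval_eq_zero_unitField _ (fun f hf => by
    obtain ⟨p, hp, rfl⟩ := List.mem_map.mp hf
    exact adapted_fibreForm p.1 (hL p hp)) hF htr

end SpecialUnitary

end Literature.MathematicalPhysics.QuantumFieldTheory.Balaban1983to89.T4NestedCovarianceFibre
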